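import Literature.Probability.RandomPlanarGeometry.SAWTriangularBridgeGrowth
import Literature.Probability.RandomPlanarGeometry.SAWBridgeRenewalEquation
import Literature.Probability.Process.RenewalSequenceRecurrence
import HarnessLib

/-!
# Irreducible bridges of the triangular lattice and the renewal equation `b_N(𝕋) = Σ_{s=1}^{N} λ_s(𝕋) b_{N−s}(𝕋)`

Topic `Literature/Probability/RandomPlanarGeometry` (lane «pcv-sawmu», door «TRI-KESTEN»; continues
`SAWTriangularBridges.lean`: the bridges `brickBridges n` / `brickBridgeCount n = b_n(𝕋)` of the triangular
lattice in the brick frame `(X, Y) = (2x₀ + x₁, x₁)` w.r.t. the height `X`, and `SAWTriangularBridgeGrowth.lean`: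
`b_0(𝕋) = 1`, `b_n(𝕋) ≤ μ(𝕋)^n`). The walks of `𝕋` in the brick frame are functions `ℕ → ℤ²` with steps
`(±2, 0)`, `(±1, ±1)` — NOT nearest-neighbour walks of `ℤ²` — so the tree's `ℤ^d` renewal theory
(`SAWBridgeRenewalEquation.lean`, `SAWKestenRelation.lean`) cannot be imported for them; what IS reused are
its purely order-theoretic predicates and lemmas on the height sequence (`Zd.IsBridge`, `Zd.IsRenewalTime`,
`Zd.IsIrreducibleBridge`, `Zd.concatWalk`, `Zd.IsBridge.append`, `Zd.exists_first_renewalTime`, …), which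
never mention the step set. Sources: H. Kesten, *On the number of self-avoiding walks*, J. Math. Phys. 4
(1963) 960–969, §4 (irreducible bridges, `ℤ^d`); N. Madras, G. Slade, *The Self-Avoiding Walk* (1993), §4.2,
Definition 4.2.1 and eq. (4.2.2) p. 90 (`b_N = Σ_{s=1}^{N} λ_s b_{N−s} + δ_{N,0}`, `ℤ^d`); for the triangular
and hexagonal lattices the renewal structure and Kesten's relation are ASSERTED AND USED in the enumeration
literature (I. Jensen, J. Phys. A 37 (2004) 11521, §2; S. E. Alm, R. Parviainen, J. Phys. A 37 (2004) 549)
by appeal to Kesten 1963, with no written proof located (lit-2 gen 12 cell) — this file is the first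
written proof text for `𝕋` (consolidation-grade port of the `ℤ^d` architecture).

What is here (all PROVED; two definitions):
* `brickIrreducibleBridges n` / `brickIrreducibleBridgeCount n = λ_n(𝕋)`: the `n`-step bridges of `𝕋` with no
  renewal time in `[1, n−1]` (`Zd.IsIrreducibleBridge` on the height sequence), `λ_0 = 0`, `λ_n ≤ b_n`;
* gluing / splitting in the brick frame: `concatWalk_mem_brickBridges`, `isRenewalTime_concatWalk_brick`,
  `not_isRenewalTime_concatWalk_brick_of_lt`, `concatWalk_injective_brick`, `headMin_mem_brickBridges`,
  `tailShift_mem_brickSaws`, `headMin_mem_brickIrreducibleBridges`, `tailShift_mem_brickBridges`;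
* **`brickBridgeCount_eq_sum_Icc`** — `b_n(𝕋) = Σ_{s=1}^{n} λ_s(𝕋) b_{n−s}(𝕋)` (`n ≥ 1`) by the bijection
  "cut at the first renewal time"; `brickBridgeCount_eq_sum_range` (renewal-equation indexing, `λ_0 = 0`);
* the FELLER consequences that need no divergence input: every partial sum of Kesten's series is at most one,
  `sum_range_brickIrreducibleBridgeCount_div_pow_le_one`, `summable_brickIrreducibleBridgeCount_div_pow`,
  `tsum_brickIrreducibleBridgeCount_div_pow_le_one`, `sum_brickIrreducibleBridgeCount_div_pow_le_one`, and the
  certificate principle of the irreducible-bridge lower bounds on `μ(𝕋)` (Jensen 2004 §2):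
  `inv_lt_exp_logMuTri_of_one_lt_sum` — `Σ_{k ∈ s} λ_k(𝕋) x^k > 1 ⇒ μ(𝕋) > 1/x`;
* `hasSum_brickIrreducibleBridgeCount_div_pow_of_not_summable` — Kesten's relation `Σ λ_k(𝕋) μ(𝕋)^{−k} = 1`
  GIVEN the divergence `Σ b_n(𝕋) μ(𝕋)^{−n} = ∞` (Feller XIII.3 Thm 2); the divergence itself (M–S Cor. 3.1.8
  on `𝕋`) is the subject of the sequel.
-/

noncomputable section

open Finset Literature.Probability.LatticeModels Literature.Probability.Percolation SimpleGraph
open scoped BigOperators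

namespace Literature.Probability.RandomPlanarGeometry.SAW

/-! ### Irreducible bridges of `𝕋` -/

open Classical in
/-- The `n`-step **irreducible bridges** of the triangular lattice (brick frame): bridges with no renewal
time in `[1, n−1]` (Madras–Slade Definition 4.2.1, on the height `X`). [cite: MadrasSlade1993, Definition 4.2.1 (p. 89)] -/
def brickIrreducibleBridges (n : ℕ) : Finset (ℕ → Site 2) :=
  (brickBridges n).filter (Zd.IsIrreducibleBridge n)

/-- `λ_n(𝕋)`, the number of `n`-step irreducible bridges of the triangular lattice. [cite: MadrasSlade1993, Definition 4.2.1 (p. 89)] -/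
def brickIrreducibleBridgeCount (n : ℕ) : ℕ := #(brickIrreducibleBridges n)

/-- Membership in `brickIrreducibleBridges`. [cite: MadrasSlade1993, Definition 4.2.1 (p. 89)] -/
theorem mem_brickIrreducibleBridges {n : ℕ} {ω : ℕ → Site 2} :
    ω ∈ brickIrreducibleBridges n ↔ ω ∈ brickBridges n ∧ Zd.IsIrreducibleBridge n ω := by
  classical
  exact Finset.mem_filter

/-- Irreducible bridges are bridges. [cite: MadrasSlade1993, Definition 4.2.1 (p. 89)] -/
theorem brickIrreducibleBridges_subset (n : ℕ) : brickIrreducibleBridges n ⊆ brickBridges n := by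
  classical
  exact Finset.filter_subset _ _

/-- `λ_n(𝕋) ≤ b_n(𝕋)`. [cite: MadrasSlade1993, Definition 4.2.1 (p. 89)] -/
theorem brickIrreducibleBridgeCount_le (n : ℕ) : brickIrreducibleBridgeCount n ≤ brickBridgeCount n :=
  Finset.card_le_card (brickIrreducibleBridges_subset n)

/-- `λ_0(𝕋) = 0` (an irreducible bridge has at least one step). [cite: MadrasSlade1993, Definition 4.2.1 (p. 89)] -/
theorem brickIrreducibleBridgeCount_zero : brickIrreducibleBridgeCount 0 = 0 := by
  rw [brickIrreducibleBridgeCount, Finset.card_eq_zero, Finset.eq_empty_iff_forall_notMem]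
  intro ω hω
  exact absurd (mem_brickIrreducibleBridges.1 hω).2.1 (by norm_num)

/-! ### Gluing an `s`-step bridge and an `(n−s)`-step bridge of `𝕋` -/

/-- **Gluing two bridges of `𝕋` gives a bridge** (the pieces are separated by their heights).
[cite: MadrasSlade1993, §1.2, eq. (1.2.15)] -/
theorem concatWalk_mem_brickBridges {n s : ℕ} {η τ : ℕ → Site 2} (hsn : s ≤ n) (hη : η ∈ brickBridges s)
    (hτ : τ ∈ brickBridges (n - s)) : Zd.concatWalk s η τ ∈ brickBridges n := by
  obtain ⟨hηs, hηb⟩ := mem_brickBridges.1 hη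
  obtain ⟨hτs, hτb⟩ := mem_brickBridges.1 hτ
  have hη0 := (mem_brickSaws.1 hηs).1
  have hτ0 := (mem_brickSaws.1 hτs).1
  have h00 : (0 : Site 2) 0 = 0 := rfl
  have hle : ∀ i ≤ s, η i 0 ≤ η s 0 := by
    intro i hi
    rcases Nat.eq_zero_or_pos i with rfl | hpos
    · rcases Nat.eq_zero_or_pos s with rfl | hs
      · exact le_rfl
      · exact (hηb s hs le_rfl).1.le
    · exact (hηb i hpos hi).2
  have hgt : ∀ j, 1 ≤ j → j ≤ n - s → η s 0 < (η s + τ j) 0 := by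
    intro j h1 h2
    have := (hτb j h1 h2).1
    rw [hτ0, h00] at this
    simp only [Pi.add_apply]
    linarith
  refine mem_brickBridges.2 ⟨?_, ?_⟩
  · have := concatWalk_mem_brickSaws hηs hτs fun i hi j h1 h2 heq => by
      have ha := hle i hi
      have hb := hgt j h1 h2
      rw [← heq] at hb
      exact absurd ha (not_le.2 hb)
    rwa [Nat.add_sub_cancel' hsn] at this
  · have h1 : Zd.IsBridge s (Zd.concatWalk s η τ) := Zd.isBridge_concatWalk_left.2 hηb
    have h2 : Zd.IsBridge (n - s) (fun j => Zd.concatWalk s η τ (s + j)) :=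
      (Zd.isBridge_concatWalk_right hτ0).2 hτb
    have := h1.append h2
    rwa [Nat.add_sub_cancel' hsn] at this

/-- The gluing time is a renewal time of the glued bridge of `𝕋`. [cite: MadrasSlade1993, §4.2, (4.2.2) (p. 90)] -/
theorem isRenewalTime_concatWalk_brick {n s : ℕ} {η τ : ℕ → Site 2} (hsn : s ≤ n) (hη : η ∈ brickBridges s)
    (hτ : τ ∈ brickBridges (n - s)) : Zd.IsRenewalTime n (Zd.concatWalk s η τ) s :=
  ⟨hsn, Zd.isBridge_concatWalk_left.2 (mem_brickBridges.1 hη).2,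
    (Zd.isBridge_concatWalk_right (mem_brickSaws.1 (mem_brickBridges.1 hτ).1).1).2 (mem_brickBridges.1 hτ).2⟩

/-- If the first piece is irreducible, the gluing time is the FIRST renewal time of the glued bridge of `𝕋`.
[cite: MadrasSlade1993, §4.2, (4.2.2) (p. 90)] -/
theorem not_isRenewalTime_concatWalk_brick_of_lt {n s k : ℕ} {η τ : ℕ → Site 2} (hsn : s ≤ n)
    (hη : η ∈ brickIrreducibleBridges s) (hk1 : 1 ≤ k) (hks : k < s) :
    ¬ Zd.IsRenewalTime n (Zd.concatWalk s η τ) k := by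
  intro hk
  obtain ⟨hηb, -, -, hirr⟩ := mem_brickIrreducibleBridges.1 hη
  have h1 : Zd.IsRenewalTime s (Zd.concatWalk s η τ) k :=
    hk.of_le hks.le hsn (Zd.isBridge_concatWalk_left.2 (mem_brickBridges.1 hηb).2)
  have h2 : Zd.IsRenewalTime s η k := h1.congr fun i hi => by rw [Zd.concatWalk_apply_of_le η τ hi]
  exact hirr k hk1 (by omega) h2

/-- Gluing at a fixed time is injective in the two pieces (brick frame). [cite: MadrasSlade1993, §1.2, eq. (1.2.15)] -/
theorem concatWalk_injective_brick {m t t' : ℕ} {ω υ ω' υ' : ℕ → Site 2} (hω : ω ∈ brickSaws m)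
    (hυ : υ ∈ brickSaws t) (hω' : ω' ∈ brickSaws m) (hυ' : υ' ∈ brickSaws t')
    (h : Zd.concatWalk m ω υ = Zd.concatWalk m ω' υ') : ω = ω' ∧ υ = υ' := by
  have hωs := mem_brickSaws.1 hω
  have hυs := mem_brickSaws.1 hυ
  have hω's := mem_brickSaws.1 hω'
  have hυ's := mem_brickSaws.1 hυ'
  have hm : ω m = ω' m := by
    have := congrFun h m
    rwa [Zd.concatWalk_apply_of_le ω υ le_rfl, Zd.concatWalk_apply_of_le ω' υ' le_rfl] at this
  have h1 : ω = ω' := funext fun i => (le_or_gt i m).elim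
    (fun hi => by simpa only [Zd.concatWalk_apply_of_le _ _ hi] using congrFun h i)
    fun hi => by rw [hωs.2.1 i hi.le, hω's.2.1 i hi.le, hm]
  refine ⟨h1, funext fun j => ?_⟩
  have := congrFun h (m + j)
  rwa [Zd.concatWalk_apply_add ω υ hυs.1, Zd.concatWalk_apply_add ω' υ' hυ's.1, hm, add_right_inj] at this

/-! ### Splitting a bridge of `𝕋` at its first renewal time -/

/-- The head `i ↦ ω (min i s)` of an `n`-step bridge of `𝕋` up to a renewal time `s` is an `s`-step bridge.
[cite: MadrasSlade1993, §4.2, (4.2.2) (p. 90)] -/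
theorem headMin_mem_brickBridges {n s : ℕ} {ω : ℕ → Site 2} (hω : ω ∈ brickBridges n)
    (hs : Zd.IsRenewalTime n ω s) : (fun i => ω (min i s)) ∈ brickBridges s := by
  obtain ⟨h0, -, hadj, hinj⟩ := mem_brickSaws.1 (mem_brickBridges.1 hω).1
  have hsn : s ≤ n := hs.1
  refine mem_brickBridges.2 ⟨mem_brickSaws.2 ⟨by simpa using h0, fun i hi => by simp [min_eq_right hi],
    fun i hi => ?_, fun i hi j hj hij => ?_⟩, hs.2.1.congr fun i hi => by simp only [min_eq_left hi]⟩
  · rw [min_eq_left hi.le, min_eq_left (Nat.succ_le_of_lt hi)]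
    exact hadj i (by omega)
  · simp only [Set.mem_setOf_eq] at hi hj
    dsimp only at hij
    rw [min_eq_left hi, min_eq_left hj] at hij
    exact hinj (by simp only [Set.mem_setOf_eq]; omega) (by simp only [Set.mem_setOf_eq]; omega) hij

/-- The tail `j ↦ ω (s + j) − ω s` of an `n`-step self-avoiding walk of `𝕋` (`s ≤ n`) is an `(n−s)`-step
self-avoiding walk of `𝕋` from the origin. [cite: MadrasSlade1993, §1.2] -/
theorem tailShift_mem_brickSaws {n s : ℕ} {ω : ℕ → Site 2} (hω : ω ∈ brickSaws n) (hs : s ≤ n) :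
    (fun j => ω (s + j) - ω s) ∈ brickSaws (n - s) := by
  obtain ⟨-, hend, hadj, hinj⟩ := mem_brickSaws.1 hω
  refine mem_brickSaws.2 ⟨by simp, fun j hj => ?_, fun j hj => ?_, fun i hi j hj hij => ?_⟩
  · rw [hend (s + j) (by omega), show s + (n - s) = n by omega]
  · rw [brickGraph_adj_sub_right, ← add_assoc]
    exact hadj (s + j) (by omega)
  · simp only [Set.mem_setOf_eq] at hi hj
    dsimp only at hij
    rw [sub_left_inj] at hij
    have := hinj (by simp only [Set.mem_setOf_eq]; omega)
      (by simp only [Set.mem_setOf_eq]; omega) hij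
    omega

/-- **The head of a bridge of `𝕋` up to its FIRST renewal time `s` is an irreducible `s`-step bridge.**
[cite: MadrasSlade1993, §4.2, (4.2.2) (p. 90)] -/
theorem headMin_mem_brickIrreducibleBridges {n s : ℕ} {ω : ℕ → Site 2} (hω : ω ∈ brickBridges n)
    (hs1 : 1 ≤ s) (hs : Zd.IsRenewalTime n ω s) (hmin : ∀ k, 1 ≤ k → k < s → ¬ Zd.IsRenewalTime n ω k) :
    (fun i => ω (min i s)) ∈ brickIrreducibleBridges s := by
  have he : ∀ i ≤ s, (fun i => ω (min i s)) i 0 = ω i 0 := fun i hi => by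
    simp only [min_eq_left hi]
  have hb := headMin_mem_brickBridges hω hs
  refine mem_brickIrreducibleBridges.2 ⟨hb, hs1, (mem_brickBridges.1 hb).2, fun k hk1 hk2 hk => ?_⟩
  exact hmin k hk1 (by omega) ((hk.congr he).trans hs)

/-- **The tail of a bridge of `𝕋` after a renewal time `s` is an `(n−s)`-step bridge.**
[cite: MadrasSlade1993, §4.2, (4.2.2) (p. 90)] -/
theorem tailShift_mem_brickBridges {n s : ℕ} {ω : ℕ → Site 2} (hω : ω ∈ brickBridges n)
    (hs : Zd.IsRenewalTime n ω s) : (fun j => ω (s + j) - ω s) ∈ brickBridges (n - s) :=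
  mem_brickBridges.2 ⟨tailShift_mem_brickSaws (mem_brickBridges.1 hω).1 hs.1,
    (Zd.isBridge_sub_const_iff _).2 hs.2.2⟩

/-! ### Madras–Slade (4.2.2) on `𝕋`: `b_n = Σ_{s=1}^{n} λ_s b_{n−s}` -/

/-- **Madras–Slade (4.2.2) on the triangular lattice**: `b_n(𝕋) = Σ_{s=1}^{n} λ_s(𝕋) b_{n−s}(𝕋)` for `n ≥ 1` —
every `n`-step bridge is, in exactly one way, an irreducible `s`-step bridge (`s` = its first renewal time)
followed by an `(n−s)`-step bridge. [cite: MadrasSlade1993, §4.2, eq. (4.2.2) (p. 90)]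
[cite: Jensen2004SAWLowerBounds, §2 (asserted for the triangular lattice)] -/
theorem brickBridgeCount_eq_sum_Icc {n : ℕ} (hn : 1 ≤ n) :
    brickBridgeCount n = ∑ s ∈ Icc 1 n, brickIrreducibleBridgeCount s * brickBridgeCount (n - s) := by
  classical
  have hcard : ((Icc 1 n).sigma fun s => brickIrreducibleBridges s ×ˢ brickBridges (n - s)).card =
      ∑ s ∈ Icc 1 n, brickIrreducibleBridgeCount s * brickBridgeCount (n - s) := by
    rw [card_sigma]
    simp_rw [card_product]
    rfl
  rw [← hcard, brickBridgeCount]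
  symm
  refine card_nbij (fun p => Zd.concatWalk p.1 p.2.1 p.2.2) ?_ ?_ ?_
  · rintro ⟨s, η, τ⟩ hp
    simp only [mem_coe, mem_sigma, mem_Icc, mem_product] at hp
    obtain ⟨⟨-, hsn⟩, hη, hτ⟩ := hp
    exact concatWalk_mem_brickBridges hsn (brickIrreducibleBridges_subset s hη) hτ
  · rintro ⟨s, η, τ⟩ hp ⟨s', η', τ'⟩ hp' h
    simp only [mem_coe, mem_sigma, mem_Icc, mem_product] at hp hp'
    obtain ⟨⟨hs1, hsn⟩, hη, hτ⟩ := hp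
    obtain ⟨⟨hs1', hsn'⟩, hη', hτ'⟩ := hp'
    dsimp only at h
    have hren := isRenewalTime_concatWalk_brick hsn (brickIrreducibleBridges_subset s hη) hτ
    have hren' := isRenewalTime_concatWalk_brick hsn' (brickIrreducibleBridges_subset s' hη') hτ'
    obtain rfl : s = s' := by
      by_contra hne
      rcases lt_or_gt_of_ne hne with hlt | hlt
      · rw [h] at hren
        exact not_isRenewalTime_concatWalk_brick_of_lt hsn' hη' hs1 hlt hren
      · rw [← h] at hren'
        exact not_isRenewalTime_concatWalk_brick_of_lt hsn hη hs1' hlt hren'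
    obtain ⟨h1, h2⟩ := concatWalk_injective_brick
      (mem_brickBridges.1 (brickIrreducibleBridges_subset s hη)).1 (mem_brickBridges.1 hτ).1
      (mem_brickBridges.1 (brickIrreducibleBridges_subset s hη')).1 (mem_brickBridges.1 hτ').1 h
    subst h1 h2
    rfl
  · intro ω hω
    rw [mem_coe] at hω
    obtain ⟨s, hs1, hs, hmin⟩ := Zd.exists_first_renewalTime hn (mem_brickBridges.1 hω).2
    refine ⟨⟨s, fun i => ω (min i s), fun j => ω (s + j) - ω s⟩, ?_, Zd.concatWalk_head_tail ω⟩
    simp only [mem_coe, mem_sigma, mem_Icc, mem_product]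
    exact ⟨⟨hs1, hs.1⟩, headMin_mem_brickIrreducibleBridges hω hs1 hs hmin, tailShift_mem_brickBridges hω hs⟩

/-- The renewal-equation indexing: `b_n(𝕋) = Σ_{k=0}^{n} λ_k(𝕋) b_{n−k}(𝕋)` for `n ≥ 1` (`λ_0 = 0`).
[cite: MadrasSlade1993, §4.2, eq. (4.2.2) (p. 90)] -/
theorem brickBridgeCount_eq_sum_range {n : ℕ} (hn : 1 ≤ n) :
    brickBridgeCount n = ∑ k ∈ range (n + 1), brickIrreducibleBridgeCount k * brickBridgeCount (n - k) := by
  rw [brickBridgeCount_eq_sum_Icc hn, range_eq_Ico, sum_eq_sum_Ico_succ_bot (show 0 < n + 1 by omega),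
    brickIrreducibleBridgeCount_zero, zero_mul, zero_add, zero_add, Finset.Ico_add_one_right_eq_Icc]

/-! ### Feller's theorem for the bridge renewal sequence of `𝕋`: partial sums of Kesten's series -/

/-- The renewal sequence `a_n = b_n(𝕋) μ(𝕋)^{−n}` and weights `p_k = λ_k(𝕋) μ(𝕋)^{−k}` satisfy the renewal
equation `a_n = Σ_{k=0}^{n} p_k a_{n−k}` (`n ≥ 1`). [cite: MadrasSlade1993, §4.2, proof of (4.2.4) (p. 91)] -/
theorem brickBridgeCount_div_pow_eq_sum {n : ℕ} (hn : 1 ≤ n) :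
    (brickBridgeCount n : ℝ) / Real.exp logMuTri ^ n = ∑ k ∈ range (n + 1),
      (brickIrreducibleBridgeCount k : ℝ) / Real.exp logMuTri ^ k *
        ((brickBridgeCount (n - k) : ℝ) / Real.exp logMuTri ^ (n - k)) := by
  rw [brickBridgeCount_eq_sum_range hn]
  push_cast
  rw [sum_div]
  refine sum_congr rfl fun k hk => ?_
  have hkn : k ≤ n := Nat.lt_succ_iff.1 (mem_range.1 hk)
  rw [div_mul_div_comm, ← pow_add, Nat.add_sub_cancel' hkn]

/-- `a_0 = b_0(𝕋) μ^0 = 1`. [cite: MadrasSlade1993, §4.2, proof of (4.2.4) (p. 91)] -/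
theorem brickBridgeCount_div_pow_zero : (brickBridgeCount 0 : ℝ) / Real.exp logMuTri ^ 0 = 1 := by
  simp [brickBridgeCount_zero]

/-- `a_n = b_n(𝕋) μ(𝕋)^{−n} ≤ 1`. [cite: MadrasSlade1993, eq. (1.2.17) (p. 12)] -/
theorem brickBridgeCount_div_pow_le_one (n : ℕ) : (brickBridgeCount n : ℝ) / Real.exp logMuTri ^ n ≤ 1 :=
  (div_le_one (pow_pos (Real.exp_pos _) n)).2 (brickBridgeCount_le_pow n)

/-- **Every partial sum of Kesten's series on `𝕋` is at most one**: `Σ_{k<N} λ_k(𝕋) μ(𝕋)^{−k} ≤ 1`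
(Feller XIII.3 for the renewal sequence `b_n μ^{−n}`; no divergence input).
[cite: MadrasSlade1993, §4.2, eq. (4.2.4) (p. 91)] [cite: Jensen2004SAWLowerBounds, §2] -/
theorem sum_range_brickIrreducibleBridgeCount_div_pow_le_one (N : ℕ) :
    ∑ k ∈ range N, (brickIrreducibleBridgeCount k : ℝ) / Real.exp logMuTri ^ k ≤ 1 :=
  Literature.Probability.Process.Renewal.sum_range_f_le_one
    (u := fun n => (brickBridgeCount n : ℝ) / Real.exp logMuTri ^ n)
    (f := fun k => (brickIrreducibleBridgeCount k : ℝ) / Real.exp logMuTri ^ k)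
    brickBridgeCount_div_pow_zero (fun n => by positivity) brickBridgeCount_div_pow_le_one
    (fun k => by positivity) (by simp [brickIrreducibleBridgeCount_zero])
    (fun n hn => brickBridgeCount_div_pow_eq_sum hn) N

/-- Kesten's series on `𝕋` is summable. [cite: MadrasSlade1993, §4.2, eq. (4.2.4) (p. 91)] -/
theorem summable_brickIrreducibleBridgeCount_div_pow :
    Summable fun k => (brickIrreducibleBridgeCount k : ℝ) / Real.exp logMuTri ^ k :=
  summable_of_sum_range_le (fun k => by positivity) sum_range_brickIrreducibleBridgeCount_div_pow_le_one

/-- `Σ' k, λ_k(𝕋) μ(𝕋)^{−k} ≤ 1`. [cite: MadrasSlade1993, §4.2, eq. (4.2.4) (p. 91)] -/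
theorem tsum_brickIrreducibleBridgeCount_div_pow_le_one :
    ∑' k, (brickIrreducibleBridgeCount k : ℝ) / Real.exp logMuTri ^ k ≤ 1 :=
  Real.tsum_le_of_sum_range_le (fun k => by positivity) sum_range_brickIrreducibleBridgeCount_div_pow_le_one

/-- `Σ_{k ∈ s} λ_k(𝕋) μ(𝕋)^{−k} ≤ 1` for every finite set `s` of lengths. [cite: MadrasSlade1993, §4.2, eq. (4.2.4) (p. 91)]
[cite: Jensen2004SAWLowerBounds, §2] -/
theorem sum_brickIrreducibleBridgeCount_div_pow_le_one (s : Finset ℕ) :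
    ∑ k ∈ s, (brickIrreducibleBridgeCount k : ℝ) / Real.exp logMuTri ^ k ≤ 1 :=
  (summable_brickIrreducibleBridgeCount_div_pow.sum_le_tsum s fun k _ => by positivity).trans
    tsum_brickIrreducibleBridgeCount_div_pow_le_one

/-- **Lower bounds on `μ(𝕋)` from irreducible bridges** (the certificate format of Jensen's / Alm–Parviainen's
lower bounds: any truncation of `Σ λ_k x^k` exceeding `1` at `x > 0` certifies `μ(𝕋) > 1/x`).
[cite: Jensen2004SAWLowerBounds, §2] [cite: MadrasSlade1993, §4.2, eq. (4.2.4) (p. 91)] -/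
theorem inv_lt_exp_logMuTri_of_one_lt_sum (s : Finset ℕ) {x : ℝ} (hx : 0 < x)
    (h : 1 < ∑ k ∈ s, (brickIrreducibleBridgeCount k : ℝ) * x ^ k) : x⁻¹ < Real.exp logMuTri := by
  by_contra hle
  rw [not_lt] at hle
  have hμ : 0 < Real.exp logMuTri := Real.exp_pos _
  have hxμ : x ≤ (Real.exp logMuTri)⁻¹ := by
    rw [← inv_inv x]; exact inv_anti₀ hμ hle
  have : ∑ k ∈ s, (brickIrreducibleBridgeCount k : ℝ) * x ^ k ≤
      ∑ k ∈ s, (brickIrreducibleBridgeCount k : ℝ) / Real.exp logMuTri ^ k := by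
    refine sum_le_sum fun k _ => ?_
    rw [div_eq_mul_inv, ← inv_pow]
    exact mul_le_mul_of_nonneg_left (pow_le_pow_left₀ hx.le hxμ k) (Nat.cast_nonneg _)
  linarith [sum_brickIrreducibleBridgeCount_div_pow_le_one s]

/-- **Kesten's relation on `𝕋`, conditional form**: if `Σ_n b_n(𝕋) μ(𝕋)^{−n} = ∞` then
`Σ_k λ_k(𝕋) μ(𝕋)^{−k} = 1` (Feller XIII.3 Theorem 2 for the bridge renewal sequence; the divergence is
Madras–Slade Corollary 3.1.8, proved for `𝕋` in the sequel). [cite: MadrasSlade1993, §4.2, eq. (4.2.4) (p. 91)]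
[cite: Jensen2004SAWLowerBounds, §2 (asserted for the triangular lattice)] -/
theorem hasSum_brickIrreducibleBridgeCount_div_pow_of_not_summable
    (hdiv : ¬ Summable fun n => (brickBridgeCount n : ℝ) / Real.exp logMuTri ^ n) :
    HasSum (fun k => (brickIrreducibleBridgeCount k : ℝ) / Real.exp logMuTri ^ k) 1 :=
  Literature.Probability.Process.Renewal.hasSum_f_one
    (u := fun n => (brickBridgeCount n : ℝ) / Real.exp logMuTri ^ n)
    (f := fun k => (brickIrreducibleBridgeCount k : ℝ) / Real.exp logMuTri ^ k)
    brickBridgeCount_div_pow_zero (fun n => by positivity) brickBridgeCount_div_pow_le_one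
    (fun k => by positivity) (by simp [brickIrreducibleBridgeCount_zero])
    (fun n hn => brickBridgeCount_div_pow_eq_sum hn) hdiv

end Literature.Probability.RandomPlanarGeometry.SAW

end
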